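import Summits.Ventures.YMGap.RobustBall.CentreBlindZ2Perimeter
import Summits.Ventures.YMGap.RobustBall.CentreProjectionEvenDomination
import HarnessLib

/-!
# RobustBall/CentreBlindZ2PerimeterTwoSides — the all-coupling bound of `CentreBlindZ2Perimeter` with exponent `R + T − 1`:
# `|⟨W_{R×T}⟩_{β,W,L}| ≤ tanh(2(d−1)·β_W)^{R+T−1}` for the whole SU(2) centre-blind class, every `β`, every torus

HONEST FRAMING: venture file of the cell `pub-ymgap` (QuantumFields programme), track Y2 ROBUST-BALL / DS seat ds-4 (g12).  Sequel of
`CentreBlindZ2Perimeter` (freeze off ONE side of the rectangle): here the frozen set is the `R` bottom links together with the `T − 1` left links above the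
corner.  A bottom link `(x + r eᵢ, i)` and a left link `(x + s eⱼ, j)` lie on a common plaquette only if `s ≡ 0` or `s ≡ −1 (mod L)`
(`sline_of_mem_torusPlaqEdges`: an `i`-link and a `j`-link of one plaquette have base points `u ∈ {z, z+eⱼ}`, `v ∈ {z, z+eᵢ}`), which the non-corner left
links (`1 ≤ s ≤ T−1 < L−1`) avoid; the GKS freezing bound (Chatterjee 2020, Lemma 7.2; Literature `gksExpect_spinProduct_le_prod_tanh`) then gives
`z2Loop βW ≤ tanh(2(d−1)βW)^{R+T−1}` and, by Mack–Petkova domination, **`su2_abs_wilsonLoop_le_tanh_pow_add : IsTwistBlind W → i ≠ j → 1 ≤ R → 1 ≤ T →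
2R ≤ L → 2T ≤ L → |⟨(1/2)tr U_{∂R×T}⟩_{β,W,L}| ≤ tanh(2(d−1)·2|β|)^{R+T−1}`** (`d = 4`: `tanh(6β_W)^{R+T−1}`; Chatterjee's exponent for the pure `ℤ₂`
theory is `ℓ − ℓ₀ = 2(R+T) − 8`).  HONEST LABEL: PERIMETER-type, NOT an area law; `SU(2)` only; finite tori; nothing continuum / spectral / Clay.

References AS PRINTED: S. Chatterjee, Comm. Math. Phys. 377 (2020) 307–340, Lemma 7.2 [arXiv181109770]; G. Mack, V. B. Petkova, Ann. Phys. 123 (1979)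
442, §2 [MackPetkova1979].
-/

noncomputable section

open Finset
open scoped symmDiff
open Literature.MathematicalPhysics.QuantumLattice (fundamentalRep)
open Literature.MathematicalPhysics.QuantumFieldTheory
open Literature.Probability.LatticeModels (SpinConfig spinAt spinProduct gksExpect siteCoupling)

namespace Summit.Ventures.YMGap.RobustBall

namespace ZTwo

variable {d L : ℕ}

/-- The line of `n` links from `y + e_m` is contained in the line of `n + 1` links from `y` (`n + 1 ≤ L`). [folklore] -/
theorem lineLinks_shift_subset [NeZero L] (m : Fin d) {n : ℕ} (hn : n + 1 ≤ L) (y : Site d L) :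
    lineLinks m n (y.shift m) ⊆ lineLinks m (n + 1) y := by
  intro e he
  obtain ⟨r, hr, rfl⟩ := exists_of_mem_lineLinks he
  rw [lineLinks_eq_image m hn y, Finset.mem_image]
  refine ⟨r + 1, Finset.mem_range.2 (by omega), Prod.ext ?_ rfl⟩
  simp only [Literature.MathematicalPhysics.QuantumFieldTheory.Site.shift, Nat.cast_succ, Pi.single_add]
  abel

/-! ### An `i`-link and a `j`-link (`i ≠ j`) share a plaquette only at a corner -/

/-- The links of `torusPlaqEdges p`, by direction: an `a`-link has base point `z` or `z + e_b`, a `b`-link has base point `z + e_a` or `z`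
(`p = (z; a < b)`). [folklore] -/
theorem mem_torusPlaqEdges_cases {p : Plaquette d L} {e : Edge d L} (he : e ∈ torusPlaqEdges p) :
    (e.2 = p.2.1.1 ∧ (e.1 = p.1 ∨ e.1 = p.1.shift p.2.1.2)) ∨ (e.2 = p.2.1.2 ∧ (e.1 = p.1.shift p.2.1.1 ∨ e.1 = p.1)) := by
  obtain ⟨z, ⟨a, b⟩, hab⟩ := p
  simp only [torusPlaqEdges, Finset.mem_insert, Finset.mem_singleton] at he
  rcases he with rfl | rfl | rfl | rfl
  · exact Or.inl ⟨rfl, Or.inl rfl⟩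
  · exact Or.inr ⟨rfl, Or.inl rfl⟩
  · exact Or.inl ⟨rfl, Or.inr rfl⟩
  · exact Or.inr ⟨rfl, Or.inr rfl⟩

/-- **A bottom link `(x + r eᵢ, i)` and a left link `(x + s eⱼ, j)` of one plaquette force `s ≡ 0` or `s ≡ −1 (mod L)`** (`i ≠ j`): an `i`-link and a
`j`-link of the same plaquette have base points `u ∈ {z, z + eⱼ}`, `v ∈ {z, z + eᵢ}`, so `u_j − v_j ∈ {0, 1}`. [folklore] -/
theorem sline_of_mem_torusPlaqEdges {p : Plaquette d L} {x : Site d L} {i j : Fin d} (hij : i ≠ j) {r s : ℕ}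
    (hb : ((x + Pi.single i ((r : ℕ) : ZMod L), i) : Edge d L) ∈ torusPlaqEdges p)
    (hl : ((x + Pi.single j ((s : ℕ) : ZMod L), j) : Edge d L) ∈ torusPlaqEdges p) :
    ((s : ℕ) : ZMod L) = 0 ∨ ((s : ℕ) : ZMod L) + 1 = 0 := by
  obtain ⟨z, ⟨a, b⟩, hab⟩ := p
  have hne : a ≠ b := (show a < b from hab).ne
  -- the j-coordinates of the two base points
  have hbj : (x + Pi.single i ((r : ℕ) : ZMod L) : Site d L) j = x j := by simp [Pi.single_eq_of_ne hij.symm]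
  have hlj : (x + Pi.single j ((s : ℕ) : ZMod L) : Site d L) j = x j + s := by simp
  rcases mem_torusPlaqEdges_cases hb with ⟨hbi, hbu⟩ | ⟨hbi, hbu⟩ <;> rcases mem_torusPlaqEdges_cases hl with ⟨hlj', hlv⟩ | ⟨hlj', hlv⟩
  · -- both of direction a: i = a = j
    exact absurd (hbi.trans hlj'.symm) hij
  · -- i = a, j = b: u ∈ {z, z + e_b = z + e_j}, v ∈ {z + e_a = z + e_i, z}
    simp only at hbi hlj' hbu hlv
    subst hbi; subst hlj'
    have hvj : (x + Pi.single j ((s : ℕ) : ZMod L) : Site d L) j = z j := by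
      rcases hlv with h | h
      · rw [h]; simp [Literature.MathematicalPhysics.QuantumFieldTheory.Site.shift, Pi.single_eq_of_ne hij.symm]
      · rw [h]
    rcases hbu with h | h
    · left
      have h1 : (x + Pi.single i ((r : ℕ) : ZMod L) : Site d L) j = z j := by rw [h]
      rw [hbj] at h1; rw [hlj, h1] at hvj
      have : z j + ((s : ℕ) : ZMod L) = z j + 0 := by rw [add_zero]; exact hvj
      exact add_left_cancel this
    · right
      have h1 : (x + Pi.single i ((r : ℕ) : ZMod L) : Site d L) j = z j + 1 := by
        rw [h]; simp [Literature.MathematicalPhysics.QuantumFieldTheory.Site.shift]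
      rw [hbj] at h1; rw [hlj, h1] at hvj
      have h2 : z j + (((s : ℕ) : ZMod L) + 1) = z j + 0 := by
        rw [add_zero, add_comm ((s : ℕ) : ZMod L) 1, ← add_assoc]; exact hvj
      exact add_left_cancel h2
  · -- i = b, j = a: u ∈ {z + e_a = z + e_j, z}, v ∈ {z, z + e_b = z + e_i}
    simp only at hbi hlj' hbu hlv
    subst hbi; subst hlj'
    have hvj : (x + Pi.single j ((s : ℕ) : ZMod L) : Site d L) j = z j := by
      rcases hlv with h | h
      · rw [h]
      · rw [h]; simp [Literature.MathematicalPhysics.QuantumFieldTheory.Site.shift, Pi.single_eq_of_ne hij.symm]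
    rcases hbu with h | h
    · right
      have h1 : (x + Pi.single i ((r : ℕ) : ZMod L) : Site d L) j = z j + 1 := by
        rw [h]; simp [Literature.MathematicalPhysics.QuantumFieldTheory.Site.shift]
      rw [hbj] at h1; rw [hlj, h1] at hvj
      have h2 : z j + (((s : ℕ) : ZMod L) + 1) = z j + 0 := by
        rw [add_zero, add_comm ((s : ℕ) : ZMod L) 1, ← add_assoc]; exact hvj
      exact add_left_cancel h2
    · left
      have h1 : (x + Pi.single i ((r : ℕ) : ZMod L) : Site d L) j = z j := by rw [h]
      rw [hbj] at h1; rw [hlj, h1] at hvj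
      have : z j + ((s : ℕ) : ZMod L) = z j + 0 := by rw [add_zero]; exact hvj
      exact add_left_cancel this
  · -- both of direction b: i = b = j
    exact absurd (hbi.trans hlj'.symm) hij

/-! ### The two-sides bound -/

/-- **`z2Loop βW ≤ tanh(2(d−1)βW)^{R+T−1}`** (`βW ≥ 0`, `L ≥ 2`, `i ≠ j`, `R ≤ L`, `R ≢ 0 mod L`, `1 ≤ T`, `2T ≤ L`): freeze off the bottom links AND the
left links above the corner — a bottom link and a non-corner left link never share a plaquette (`sline_of_mem_torusPlaqEdges`).
[cite: arXiv181109770, Lemma 7.2] -/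
theorem z2Loop_le_tanh_pow_two_sides [NeZero L] [Fact (1 < L)] {βW : ℝ} (hβ : 0 ≤ βW) {x : Site d L} {i j : Fin d} {R T : ℕ} (hij : i ≠ j)
    (hR : R ≤ L) (hR0 : ((R : ℕ) : ZMod L) ≠ 0) (hT1 : 1 ≤ T) (hTL : 2 * T ≤ L) :
    z2Loop βW x i j R T ≤ Real.tanh (2 * (d - 1 : ℕ) * βW) ^ (R + (T - 1)) := by
  classical
  have hL2 : 2 ≤ L := (Fact.out : 1 < L)
  have hTL' : T ≤ L := by omega
  have hT0 : ((T : ℕ) : ZMod L) ≠ 0 := fun h =>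
    absurd (Nat.le_of_dvd (by omega) ((ZMod.natCast_eq_zero_iff T L).1 h)) (by omega)
  -- the frozen set: bottom links and the left links above the corner
  set A₁ : Finset (Edge d L) := lineLinks i R x ∪ lineLinks j (T - 1) (x.shift j) with hA₁
  have hleft' : lineLinks j (T - 1) (x.shift j) ⊆ lineLinks j T x := by
    have := lineLinks_shift_subset j (n := T - 1) (by omega) x
    rwa [Nat.sub_add_cancel hT1] at this
  have hA : A₁ ⊆ loopLinks x i j R T := Finset.union_subset (lineLinks_subset_loopLinks hij hT0)
    (hleft'.trans (lineLinks_left_subset_loopLinks hij hR0))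
  have hfun : (plaqLinks : Plaquette d L → Finset (Edge d L)) = torusPlaqEdges := funext plaqLinks_eq_torusPlaqEdges
  -- separation
  have hsep : ∀ p ∈ (Finset.univ : Finset (Plaquette d L)), (torusPlaqEdges p ∩ A₁).card ≤ 1 := by
    intro p _
    rw [← plaqLinks_eq_torusPlaqEdges]
    refine Finset.card_le_one.2 fun e he e' he' => ?_
    rw [Finset.mem_inter, hA₁, Finset.mem_union] at he he'
    -- a bottom link and a shifted-left link of the same plaquette: impossible
    have key : ∀ {f g : Edge d L}, f ∈ plaqLinks p → f ∈ lineLinks i R x → g ∈ plaqLinks p → g ∈ lineLinks j (T - 1) (x.shift j) → False := by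
      intro f g hf hfB hg hgL
      obtain ⟨r, -, rfl⟩ := exists_of_mem_lineLinks hfB
      obtain ⟨s', hs', rfl⟩ := exists_of_mem_lineLinks hgL
      rw [plaqLinks_eq_torusPlaqEdges] at hf hg
      have hshift : ((x.shift j + Pi.single j ((s' : ℕ) : ZMod L), j) : Edge d L) = (x + Pi.single j (((s' + 1 : ℕ) : ℕ) : ZMod L), j) := by
        refine Prod.ext ?_ rfl
        simp only [Literature.MathematicalPhysics.QuantumFieldTheory.Site.shift, Nat.cast_succ, Pi.single_add]
        abel
      rw [hshift] at hg
      rcases sline_of_mem_torusPlaqEdges hij hf hg with h0 | h1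
      · exact absurd (Nat.le_of_dvd (by omega) ((ZMod.natCast_eq_zero_iff (s' + 1) L).1 h0)) (by omega)
      · have h2 : (((s' + 1 + 1 : ℕ) : ℕ) : ZMod L) = 0 := by push_cast at h1 ⊢; exact h1
        exact absurd (Nat.le_of_dvd (by omega) ((ZMod.natCast_eq_zero_iff (s' + 1 + 1) L).1 h2)) (by omega)
    rcases he with ⟨hep, heB | heL⟩ <;> rcases he' with ⟨hep', heB' | heL'⟩
    · exact Finset.card_le_one.1 (card_plaqLinks_inter_lineLinks_le_one p i R x) e (Finset.mem_inter.2 ⟨hep, heB⟩) e'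
        (Finset.mem_inter.2 ⟨hep', heB'⟩)
    · exact (key hep heB hep' heL').elim
    · exact (key hep' heB' hep heL).elim
    · exact Finset.card_le_one.1 (card_plaqLinks_inter_lineLinks_le_one p j (T - 1) (x.shift j)) e (Finset.mem_inter.2 ⟨hep, heL⟩) e'
        (Finset.mem_inter.2 ⟨hep', heL'⟩)
  -- cardinality of the frozen set
  have hdisj : Disjoint (lineLinks i R x) (lineLinks j (T - 1) (x.shift j)) := by
    rw [Finset.disjoint_left]
    intro e heB heL
    exact hij ((snd_eq_of_mem_lineLinks heB).symm.trans (snd_eq_of_mem_lineLinks heL))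
  have hcard : A₁.card = R + (T - 1) := by
    rw [hA₁, Finset.card_union_of_disjoint hdisj, card_lineLinks i hR x, card_lineLinks j (by omega) (x.shift j)]
  unfold z2Loop
  rw [hfun]
  calc gksExpect (Finset.univ : Finset (Plaquette d L)) (fun _ => βW) torusPlaqEdges (spinProduct (loopLinks x i j R T))
      ≤ ∏ a ∈ A₁, Real.tanh (siteCoupling (Finset.univ : Finset (Plaquette d L)) (fun _ => βW) torusPlaqEdges a) :=
        Literature.Probability.LatticeModels.gksExpect_spinProduct_le_prod_tanh _ _ _ (fun _ _ => hβ) hA hsep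
    _ ≤ ∏ _a ∈ A₁, Real.tanh (2 * (d - 1 : ℕ) * βW) := by
        refine Finset.prod_le_prod (fun a _ => Literature.MathematicalPhysics.QuantumFieldTheory.tanh_nonneg (siteCoupling_torus_nonneg hβ a))
          fun a _ => ?_
        exact Literature.MathematicalPhysics.QuantumFieldTheory.tanh_le_tanh (siteCoupling_torus_le hβ a)
    _ = Real.tanh (2 * (d - 1 : ℕ) * βW) ^ (R + (T - 1)) := by rw [Finset.prod_const, hcard]

/-- **ALL-COUPLING BOUND, perimeter exponent `R + T − 1`** (every torus `L`, non-wrapping rectangle `1 ≤ R, T`, `2R, 2T ≤ L`, `i ≠ j`, every `β`, every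
twist-blind `W`): `|⟨W_{R×T}⟩_{β,W,L}| ≤ tanh(2(d−1)·2|β|)^{R+T−1}`. [cite: arXiv181109770, Lemma 7.2] -/
theorem su2_abs_wilsonLoop_le_tanh_pow_add [NeZero L] (W : Perturbation d L 2) (hW : IsTwistBlind W) (β : ℝ) {x : Site d L}
    {i j : Fin d} {R T : ℕ} (hij : i ≠ j) (hR1 : 1 ≤ R) (hT1 : 1 ≤ T) (hR : 2 * R ≤ L) (hT : 2 * T ≤ L) :
    |W.expectation (fundamentalRep (Fin 2)) β (wilsonLoop (fundamentalRep (Fin 2)) x i j R T)| ≤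
      Real.tanh (2 * (d - 1 : ℕ) * (2 * |β|)) ^ (R + T - 1) := by
  haveI : Fact (1 < L) := ⟨by omega⟩
  have hR0 : ((R : ℕ) : ZMod L) ≠ 0 := fun h =>
    absurd (Nat.le_of_dvd (by omega) ((ZMod.natCast_eq_zero_iff R L).1 h)) (by omega)
  have hz := z2Loop_le_tanh_pow_two_sides (βW := 2 * |β|) (x := x) (by positivity) hij (by omega) hR0 hT1 hT
  have h := su2_abs_wilsonLoop_le_of_z2Loop_le hz W hW
  rwa [show R + (T - 1) = R + T - 1 by omega] at h


end ZTwo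

/-! ### Even `N`: the all-coupling bounds transfer through Mack–Petkova domination (`CentreProjectionEvenDomination`) -/

/-- **ALL-COUPLING BOUND FOR `SU(N)`, `N` EVEN** (every torus `L`, non-wrapping rectangle `1 ≤ R, T`, `2R, 2T ≤ L`, `i ≠ j`, every `β`, every
twist-blind `W`): `|⟨(1/N) Re tr U_{∂R×T}⟩_{β,W,L}| ≤ tanh(2(d−1)·N|β|)^{max(R,T)}` — domination by `ℤ₂` lattice gauge theory at `β₂ = N|β|`
(`suN_even_abs_wilsonLoop_le_of_z2Loop_le`) plus the GKS freezing bound `ZTwo.z2Loop_le_tanh_pow_max`.  Perimeter-type, NOT an area law (seat ds-4 g12 text,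
filed by g13 here because its parent is this file's parent). [cite: arXiv181109770, Lemma 7.2] -/
theorem suN_even_abs_wilsonLoop_le_tanh_pow_of_nonwrapping {d L N : ℕ} [NeZero L] [NeZero N] (hN : Even N) (W : Perturbation d L N) (hW : IsTwistBlind W)
    (β : ℝ) {x : Site d L} {i j : Fin d} {R T : ℕ} (hij : i ≠ j) (hR1 : 1 ≤ R) (hT1 : 1 ≤ T) (hR : 2 * R ≤ L) (hT : 2 * T ≤ L) :
    |W.expectation (fundamentalRep (Fin N)) β (wilsonLoop (fundamentalRep (Fin N)) x i j R T)| ≤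
      Real.tanh (2 * (d - 1 : ℕ) * ((N : ℝ) * |β|)) ^ max R T := by
  haveI : Fact (1 < L) := ⟨by omega⟩
  have hR0 : ((R : ℕ) : ZMod L) ≠ 0 := fun h =>
    absurd (Nat.le_of_dvd (by omega) ((ZMod.natCast_eq_zero_iff R L).1 h)) (by omega)
  have hT0 : ((T : ℕ) : ZMod L) ≠ 0 := fun h =>
    absurd (Nat.le_of_dvd (by omega) ((ZMod.natCast_eq_zero_iff T L).1 h)) (by omega)
  exact suN_even_abs_wilsonLoop_le_of_z2Loop_le hN
    (ZTwo.z2Loop_le_tanh_pow_max (by positivity) hij (by omega) (by omega) hR0 hT0) W hW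

/-- **TWO-SIDED ALL-COUPLING BOUND FOR `SU(N)`, `N` EVEN**: `|⟨(1/N) Re tr U_{∂R×T}⟩_{β,W,L}| ≤ tanh(2(d−1)·N|β|)^{R+T−1}` (every torus, non-wrapping
`1 ≤ R, T`, `2R, 2T ≤ L`, every `β`, every twist-blind `W`; `ZTwo.z2Loop_le_tanh_pow_two_sides` at `β₂ = N|β|`).  Perimeter-type, NOT an area law.
[cite: arXiv181109770, Lemma 7.2] -/
theorem suN_even_abs_wilsonLoop_le_tanh_pow_add {d L N : ℕ} [NeZero L] [NeZero N] (hN : Even N) (W : Perturbation d L N) (hW : IsTwistBlind W) (β : ℝ)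
    {x : Site d L} {i j : Fin d} {R T : ℕ} (hij : i ≠ j) (hR1 : 1 ≤ R) (hT1 : 1 ≤ T) (hR : 2 * R ≤ L) (hT : 2 * T ≤ L) :
    |W.expectation (fundamentalRep (Fin N)) β (wilsonLoop (fundamentalRep (Fin N)) x i j R T)| ≤
      Real.tanh (2 * (d - 1 : ℕ) * ((N : ℝ) * |β|)) ^ (R + T - 1) := by
  haveI : Fact (1 < L) := ⟨by omega⟩
  have hR0 : ((R : ℕ) : ZMod L) ≠ 0 := fun h =>
    absurd (Nat.le_of_dvd (by omega) ((ZMod.natCast_eq_zero_iff R L).1 h)) (by omega)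
  have h := ZTwo.z2Loop_le_tanh_pow_two_sides (d := d) (βW := (N : ℝ) * |β|) (by positivity) (x := x) hij (by omega) hR0 hT1 hT
  have e : R + (T - 1) = R + T - 1 := by omega
  rw [e] at h
  exact suN_even_abs_wilsonLoop_le_of_z2Loop_le hN h W hW

end Summit.Ventures.YMGap.RobustBall

end
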